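import Mathlib
import Summits.ValiantsHypothesis.ValiantsHypothesis.Theses.FreeSubtorus
import Summits.ValiantsHypothesis.ValiantsHypothesis.Theorems.FreeSubtorusSubtorusCovering
import Summits.ValiantsHypothesis.ValiantsHypothesis.Theorems.FreeSubtorusConfusionCoveringGenericElement
import Summits.ValiantsHypothesis.ValiantsHypothesis.Cruxes.OrbitDimensionBound.Lines.NoMinorLadder

/-!
# `no_minor_covering` — SPECIAL CASES (forward rung g5, crux `FreeSubtorus.OrbitDimensionBound`)

Sorry-free checks that the rung family `NoMinor.CoveringOn 𝓐` / the rung `NoMinor.NoMinorCovering` sits correctly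
relative to the proved floor (seed `g1-ValiantsHypothesis-16134`,
`Theorems.FreeSubtorusSubtorusCovering.subtorusCovering_proof`):

* (a) the member `𝓐 = Admissible` IS the floor: `CoveringOn Admissible` holds outright by `simpa using` the seed,
  and `CoveringOn Admissible ↔ SubtorusCovering` is `Iff.rfl`.
* (b) the rung implies the floor (`rung → seed`), the dial is antitone in the class, the top member implies the rung:
  a genuine ladder above the floor.
* (c) FIRST RUNG OF THE NEW STUB 1: the ADMISSIBLE case of `stub_genericElementNoMinor` follows from the LANDED
  `stub_genericElement` (its "no non-negative relation" clause (ii) kills every proper sub-matching product).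
* (d) the host crux implies the relaxed symmetrisation target: `OrbitDimensionBound → OrbitNoMinorBound`.
* (e) the move is REAL: the per-invariant torus `Λ = 𝟙` (`r = 1`) is in the rung's class and NOT in the floor's.
-/

set_option linter.dupNamespace false

noncomputable section

namespace Summit.ValiantsHypothesis.ValiantsHypothesis.Cruxes.OrbitDimensionBound.NoMinor.Special

open Finset
open Literature.Computability.AlgebraicComplexity
open Summit.ValiantsHypothesis.ValiantsHypothesis.Cruxes.OrbitDimensionBound.NoMinor

/-- (a) the floor parameters of the family: `𝓐 = Admissible` is the seed theorem. -/
example : CoveringOn Admissible := by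
  simpa [CoveringOn, Admissible, Summit.ValiantsHypothesis.ValiantsHypothesis.Theses.FreeSubtorus.SubtorusCovering] using
    Summit.ValiantsHypothesis.ValiantsHypothesis.Theorems.FreeSubtorusSubtorusCovering.subtorusCovering_proof

/-- (a, term form) the seed IS the member, definitionally. -/
example : CoveringOn Admissible :=
  fun n hn m r Λ B hΛ hB =>
    Summit.ValiantsHypothesis.ValiantsHypothesis.Theorems.FreeSubtorusSubtorusCovering.subtorusCovering_proof n hn m r Λ B hΛ hB

/-- (a') … literally (`Iff.rfl`). -/
example : CoveringOn Admissible ↔ Summit.ValiantsHypothesis.ValiantsHypothesis.Theses.FreeSubtorus.SubtorusCovering :=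
  Iff.rfl

/-- (b) the rung implies the floor (seed `g1-ValiantsHypothesis-16134`). -/
theorem floor_of_rung (h : NoMinorCovering) :
    Summit.ValiantsHypothesis.ValiantsHypothesis.Theses.FreeSubtorus.SubtorusCovering :=
  subtorusCovering_of_noMinorCovering h

/-- (b') the dial is antitone: a bigger lattice class is a stronger statement. -/
example {𝓐 𝓑 : LatticeClass} (hle : ∀ n r Λ, 𝓐 n r Λ → 𝓑 n r Λ) (h : CoveringOn 𝓑) : CoveringOn 𝓐 :=
  CoveringOn.anti hle h

/-- (b'') the top member (all lattices) implies the rung. -/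
example (h : AnyLatticeCovering) : NoMinorCovering := noMinorCovering_of_anyLatticeCovering h

/-- (c) **First rung of the new stub 1**: for ADMISSIBLE `Λ` the conclusion of `stub_genericElementNoMinor`
(relations, exact separation, no proper sub-matching of weight product `1`) follows from the landed
`stub_genericElement`. [cite: LandsbergRessayre2017, §6] -/
theorem genericElementNoMinor_admissible (n r : ℕ) (Λ : Fin r → (Fin n ⊕ Fin n) → ℤ) (hΛ : Admissible n r Λ) :
    ∃ d e : Fin n → ℂˣ,
      (∀ i, (∏ k, (d k) ^ (Λ i (Sum.inl k))) * (∏ l, (e l) ^ (Λ i (Sum.inr l))) = 1) ∧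
      (∀ χ : (Fin n ⊕ Fin n) → ℤ,
        (∏ k, (d k) ^ (χ (Sum.inl k))) * (∏ l, (e l) ^ (χ (Sum.inr l))) = 1 →
        ∃ (N : ℤ) (a : Fin r → ℤ), N ≠ 0 ∧ N • χ = ∑ i, a i • Λ i) ∧
      (∀ (σ : Equiv.Perm (Fin n)) (M : Finset (Fin n)), M.Nonempty → M ≠ Finset.univ →
        (∏ k ∈ M, ((d k : ℂ) * (e (σ k) : ℂ))) ≠ 1) := by
  classical
  obtain ⟨d, e, hrel, hnonneg, hsep⟩ :=
    Summit.ValiantsHypothesis.ValiantsHypothesis.Theorems.FreeSubtorusConfusionCovering.stub_genericElement n r Λ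
      (fun i => (hΛ i).1)
  refine ⟨d, e, hrel, hsep, fun σ M hM _ hprod => ?_⟩
  -- `u` = indicator of the graph of `σ` over `M`, a non-zero exponent vector
  let u : Fin n × Fin n → ℕ := fun p => if p.1 ∈ M ∧ p.2 = σ p.1 then 1 else 0
  have hu0 : u ≠ 0 := by
    obtain ⟨k, hk⟩ := hM
    intro h0
    have h1 := congr_fun h0 (k, σ k)
    simp [u, hk] at h1
  refine hnonneg u hu0 ?_
  calc ∏ p : Fin n × Fin n, ((d p.1 : ℂ) * (e p.2 : ℂ)) ^ (u p)
      = ∏ k : Fin n, ∏ l : Fin n, ((d k : ℂ) * (e l : ℂ)) ^ (u (k, l)) := Fintype.prod_prod_type _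
    _ = ∏ k : Fin n, (if k ∈ M then (d k : ℂ) * (e (σ k) : ℂ) else 1) := by
        refine Finset.prod_congr rfl fun k _ => ?_
        rw [Finset.prod_eq_single (σ k)]
        · by_cases hk : k ∈ M <;> simp [u, hk]
        · intro l _ hl
          simp [u, hl]
        · intro h
          exact absurd (Finset.mem_univ _) h
    _ = ∏ k ∈ M, ((d k : ℂ) * (e (σ k) : ℂ)) := by
        rw [Finset.prod_ite_mem, Finset.univ_inter]
    _ = 1 := hprod

/-- (d) the host crux `OrbitDimensionBound` implies the relaxed target `OrbitNoMinorBound`. -/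
example (h : Summit.ValiantsHypothesis.ValiantsHypothesis.Theses.FreeSubtorus.OrbitDimensionBound) :
    OrbitNoMinorBound :=
  orbitNoMinorBound_of_orbitDimensionBound h

/-- (e) the move is real: the per-invariant torus (`Λ = 𝟙`, `r = 1`) is in the rung's class … -/
example (n : ℕ) : NoInvariantMinor n 1 (fun _ _ => 1) := noInvariantMinor_ones n

/-- … and outside the floor's (for `n ≥ 1`). -/
example (n : ℕ) (hn : 1 ≤ n) : ¬ Admissible n 1 (fun _ _ => 1) := not_admissible_ones n hn

end Summit.ValiantsHypothesis.ValiantsHypothesis.Cruxes.OrbitDimensionBound.NoMinor.Special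

end
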